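import Summits.BirchSwinnertonDyer.BirchSwinnertonDyer.Theorems.GenusKolyvaginAtTwoGenusPrimitiveSupplyAtTwoArchimedeanUnramifiedRowsHold
import Summits.BirchSwinnertonDyer.BirchSwinnertonDyer.Theorems.GenusKolyvaginAtTwoGenusPrimitiveSupplyAtTwoPrimeHeegnerTwinPosDisc
import Literature.NumberTheory.QuadraticFields.KroneckerSplitting
import HarnessLib

/-!
# Route `GenusKolyvaginAtTwo`, crux #2 `GenusPrimitiveSupplyAtTwo` (stmt-BirchSwinnertonDyer-22136):
# the `Δ > 0` DEF = 1 supply with `2` INERT — silent prime Heegner fields `ℚ(√−ℓ)`, `ℓ ≡ 3 (mod 8)`, for curves good at `2`,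
# UNCONDITIONALLY (T-A⁵ is a tree theorem)

Width seat `bsd-line-gk2-p5` g12 (cell `bsd-f1-sign2`, SUPPLY lineage), file 48 of the series: the `2`-inert companion of the lineage's g7
file `…PrimeHeegnerTwinPosDisc` (§2–§3: silent prime Heegner fields `ℓ ≡ 7 (mod 8)` are `DescAdmissible`; SUPPLY″-Selmer on
`{Δ > 0, #Sel₂ = 1}` modulo T-A) on top of `…ArchimedeanUnramifiedRowsHold` (§101: T-A⁵ `unramifiedTwistSelmerShiftAtTwo_holds`, no
hypothesis). THEOREMS ONLY (no definition, no named fact, no `sorry`, no local instance); helper `--supports stmt-BirchSwinnertonDyer-22136`;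
no item is closed; BSD is not proved by any of this.

WHAT. Every prime-Heegner-field supply of the lineage asks `ℓ ≡ 7 (mod 8)` so that `2` splits in `K = ℚ(√−ℓ)` — needed twice: for the
Heegner hypothesis at `2 ∣ N_W`, and for the twist law at the dyadic place (split row). For curves with `2 ∤ N_W` (good at `2`) the first
need is void and the second is now served by Mazur's norm theorem (T-A⁵): `ℓ ≡ 3 (mod 8)` (`2` INERT in `K`) is as good.

* §107 `exists_heegnerField_of_prime_inert` — `ℓ ≡ 3 (mod 8)` prime, `ℓ ≡ −1 (mod p)` for every odd `p ∣ N_W`, `2 ∤ N_W` ⟹ `ℓ ∤ N_W`,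
  `ℓ ∤ Δ_min`, and `K = ℚ(√−ℓ)` is imaginary quadratic with `d_K = −ℓ` odd `≠ −3`, Heegner for `N_W`, `2` NOT split, and the two
  non-square clauses of crux 22136 (file `…PrimeHeegnerTwinRowOne` §1 verbatim with the dyadic clause replaced);
* §108 `descAdmissibleUnram_neg_prime_of_silent`, `exists_silent_heegnerField_of_prime_inert` — a SILENT such `ℓ` (no root of the
  `2`-division cubic mod `ℓ`, i.e. `a_ℓ` odd) gives `F1Sign2.DescAdmissibleUnram W (−ℓ)` and `E(ℚ_ℓ)[2] = 0` (DEF(W,K) = 1 on `Δ > 0`);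
* §109 **`supply_DEF1_posDisc_inert`** — on `{Δ_W > 0, E(ℚ)[2] = 0, #Sel₂(W) = 1, 2 ∤ N_W}` every silent `ℓ ≡ 3 (mod 8)`, `ℓ ≡ −1 (p ∣ N_W odd)`
  supplies `K = ℚ(√−ℓ)` with every K-clause of the crux (`2` inert) and a GLOBALLY MINIMAL twin `Wd ≅ W^{(−ℓ)}` with `#Sel₂(Wd) = 2` —
  UNCONDITIONAL (T-A⁵ by name is the theorem `unramifiedTwistSelmerShiftAtTwo_holds`); `strictShaPropagation_unram` and
  `twistSelmerTwoCard_unram_eq_iff_admissible` — on `#Sel₂(W) = 4` the unramified-admissible twists fall on the SAME side of the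
  visibility dichotomy as the split-admissible ones (both `2` or both `8`).

Honest framing: supply statements of the route's UP lane widened to `2`-inert fields; they do NOT touch (U) 24947 / (CONV₂) 19220; the twin's
analytic rank is NOT asserted; beyond-print theorem: no; BSD is not proved by any of this.

References: [Kramer1981] Props. 3, 6, Thm. 1; [Mazur1972] Cor. 4.4; [MazurRubin2010] Lemmas 2.2 (i), 2.9–2.10, Cor. 3.4; [GrossLMS1991] §1
(p. 235); [Cox2013] §1.
-/

set_option linter.dupNamespace false -- tree convention: `Summit.BirchSwinnertonDyer.BirchSwinnertonDyer.Theorems` (summit = sub-problem)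
set_option autoImplicit false

noncomputable section

open scoped Classical

open NumberField WeierstrassCurve Literature.NumberTheory.EllipticCurves Literature.NumberTheory.QuadraticFields
open Literature.NumberTheory.GaloisRepresentations Literature.NumberTheory.GaloisCohomology
open Summit.BirchSwinnertonDyer.Rank1Residual.F1Sign2
open Summit.BirchSwinnertonDyer.BirchSwinnertonDyer.Theorems.GenusKolyArch

namespace Summit.BirchSwinnertonDyer.BirchSwinnertonDyer.Theorems.GenusKolyTwin

variable (W : WeierstrassCurve ℚ) [W.IsElliptic] [W.IsGloballyMinimal]

/-! ## §107 The Heegner field `ℚ(√−ℓ)` of a given prime `ℓ ≡ 3 (mod 8)` for a curve good at `2` -/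

omit [W.IsGloballyMinimal] in
/-- A nonzero rational with ODD `q`-adic valuation at some prime `q` is not a square in `ℚ`. [folklore] -/
private theorem not_isSquare_of_odd_padicValRat {q : ℕ} [Fact q.Prime] {x : ℚ} (hx : x ≠ 0)
    (hodd : Odd (padicValRat q x)) : ¬ IsSquare x := by
  rintro ⟨y, rfl⟩
  have hy : y ≠ 0 := fun h => hx (by rw [h, mul_zero])
  rw [padicValRat.mul hy hy, ← two_mul] at hodd
  exact (Int.not_odd_iff_even.mpr (even_two_mul _)) hodd

/-- **The Heegner field of a given prime `ℓ ≡ 3 (mod 8)`, for a curve good at `2`.** For `W/ℚ` globally minimal elliptic with `2 ∤ N_W`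
and a prime `ℓ ≡ 3 (mod 8)`, `ℓ ≠ 3`, with `ℓ ≡ −1 (mod p)` for every odd prime `p ∣ N_W`: `ℓ ∤ N_W`, `ℓ ∤ Δ_min(W)`, and there is a number field
`K` (`= ℚ(√−ℓ)`) with `d_K = −ℓ`, imaginary quadratic, `d_K` odd and `≠ −3`, satisfying the Heegner hypothesis for `N_W` (every `p ∣ N_W`
is odd and `(−ℓ/p) = 1`), in which `2` does NOT split (`d_K ≡ 5 (mod 8)`: inert), with `d_K·(−|Δ_W|)`, `d_K·(−2|Δ_W|)` non-squares.
[cite: GrossLMS1991, §1 (p. 235)] [cite: Cox2013, §1] -/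
theorem exists_heegnerField_of_prime_inert {ℓ : ℕ} (hℓ : ℓ.Prime) (hℓ8 : ℓ % 8 = 3) (hℓ3 : ℓ ≠ 3) (h2N : ¬ 2 ∣ W.conductorNorm ℤ)
    (hℓN : ∀ p : ℕ, p.Prime → p ∣ W.conductorNorm ℤ → p ≠ 2 → (ℓ : ZMod p) = -1) :
    ¬ ℓ ∣ W.conductorNorm ℤ ∧ ¬ (ℓ : ℤ) ∣ minimalDiscriminantInt W ∧
    ∃ (K : Type) (_ : Field K) (_ : NumberField K), IsImaginaryQuadratic K ∧ discr K = -(ℓ : ℤ) ∧ Odd (discr K) ∧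
      discr K ≠ -3 ∧ SatisfiesHeegnerHypothesis (W.conductorNorm ℤ) K ∧
      ((Ideal.span {(2 : ℤ)}).primesOver (𝓞 K)).ncard ≠ 2 ∧
      ¬ IsSquare ((discr K : ℚ) * -|W.Δ|) ∧ ¬ IsSquare ((discr K : ℚ) * (-(2 * |W.Δ|))) := by
  haveI := Fact.mk hℓ
  have hℓ2 : ℓ ≠ 2 := by omega
  -- `ℓ ∤ N_W`: otherwise `ℓ ≡ −1 (mod ℓ)`
  have hℓN' : ¬ ℓ ∣ W.conductorNorm ℤ := by
    intro h
    have h0 : ((ℓ : ℕ) : ZMod ℓ) = -1 := hℓN ℓ hℓ h hℓ2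
    rw [ZMod.natCast_self] at h0
    exact one_ne_zero (neg_eq_zero.mp h0.symm)
  have hℓΔ : ¬ (ℓ : ℤ) ∣ minimalDiscriminantInt W := fun h =>
    hℓN' (dvd_conductorNorm_of_dvd_minimalDiscriminantInt W hℓ h)
  -- the field `ℚ(√−ℓ)`
  have hD : ((-(ℓ : ℤ)) % 4 = 1 ∧ Squarefree (-(ℓ : ℤ)) ∧ -(ℓ : ℤ) ≠ 1) ∨
      (4 ∣ -(ℓ : ℤ) ∧ (-(ℓ : ℤ) / 4 % 4 = 2 ∨ -(ℓ : ℤ) / 4 % 4 = 3) ∧ Squarefree (-(ℓ : ℤ) / 4)) := by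
    refine Or.inl ⟨by omega, ?_, by omega⟩
    rw [← Int.squarefree_natAbs]
    simpa using hℓ.squarefree
  obtain ⟨K, _, _, h2, hdisc⟩ := Quadratic.exists_numberField_discr_eq hD
  have hK : IsImaginaryQuadratic K :=
    ⟨h2, Quadratic.isTotallyComplex_of_discr_neg h2 (by rw [hdisc, neg_lt_zero]; exact_mod_cast hℓ.pos)⟩
  have hH : SatisfiesHeegnerHypothesis (W.conductorNorm ℤ) K := by
    intro p hp hpN
    by_cases hp2 : p = 2
    · subst hp2
      exact absurd hpN h2N
    · exact Quadratic.ncard_primesOver_eq_two_of_discr_eq_neg h2 hdisc hp hp2 (hℓN p hp hpN hp2)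
  have h2inert : ((Ideal.span {(2 : ℤ)}).primesOver (𝓞 K)).ncard ≠ 2 := by
    rw [Ne, Quadratic.ncard_primesOver_two_eq_two_iff h2, hdisc]
    omega
  -- `ℓ`-adic valuations
  have hℓQ : (ℓ : ℚ) ≠ 0 := by exact_mod_cast hℓ.ne_zero
  have hΔQ : (W.Δ : ℚ) ≠ 0 := W.isUnit_Δ.ne_zero
  have hvΔ : padicValRat ℓ W.Δ = 0 := by
    rw [← cast_minimalDiscriminantInt W, padicValRat.of_int, Int.natCast_eq_zero, padicValInt.eq_zero_of_not_dvd hℓΔ]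
  have hvΔabs : padicValRat ℓ |W.Δ| = 0 := by
    rcases abs_choice W.Δ with h | h
    · rw [h, hvΔ]
    · rw [h, padicValRat.neg, hvΔ]
  have hv2 : padicValRat ℓ (2 : ℚ) = 0 := by
    have h2' : ¬ ℓ ∣ 2 := fun h => by have := Nat.le_of_dvd two_pos h; omega
    rw [show (2 : ℚ) = ((2 : ℕ) : ℚ) by norm_num, padicValRat.of_nat, padicValNat.eq_zero_of_not_dvd h2', Nat.cast_zero]
  have hy0 : (ℓ : ℚ) * |W.Δ| ≠ 0 := mul_ne_zero hℓQ (abs_ne_zero.mpr hΔQ)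
  have hy : padicValRat ℓ ((ℓ : ℚ) * |W.Δ|) = 1 := by
    rw [padicValRat.mul hℓQ (abs_ne_zero.mpr hΔQ), padicValRat.self hℓ.one_lt, hvΔabs, add_zero]
  refine ⟨hℓN', hℓΔ, K, inferInstance, inferInstance, hK, hdisc, by rw [hdisc, Int.odd_iff]; omega, by rw [hdisc]; omega, hH,
    h2inert, ?_, ?_⟩
  · have hx : ((discr K : ℤ) : ℚ) * -|W.Δ| = (ℓ : ℚ) * |W.Δ| := by rw [hdisc]; push_cast; ring
    rw [hx]
    exact not_isSquare_of_odd_padicValRat (q := ℓ) hy0 (by rw [hy]; exact odd_one)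
  · have hx : ((discr K : ℤ) : ℚ) * (-(2 * |W.Δ|)) = 2 * ((ℓ : ℚ) * |W.Δ|) := by rw [hdisc]; push_cast; ring
    rw [hx]
    refine not_isSquare_of_odd_padicValRat (q := ℓ) (mul_ne_zero two_ne_zero hy0) ?_
    rw [padicValRat.mul two_ne_zero hy0, hy, hv2, zero_add]
    exact odd_one

/-! ## §108 A silent prime `ℓ ≡ 3 (mod 8)` is an unramified-admissible (`-desc`) twist parameter -/

/-- **Silent prime Heegner fields with `2` inert are `DescAdmissibleUnram`.** For `W/ℚ` globally minimal elliptic with `2 ∤ N_W` and a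
SILENT prime `ℓ ≡ 3 (mod 8)` with `ℓ ≡ −1 (mod p)` for every odd prime `p ∣ N_W` (no root of the `2`-division cubic mod `ℓ`): `d = −ℓ`
satisfies `F1Sign2.DescAdmissibleUnram W d` (`d < 0`, squarefree, `d ≡ 5 (8)`, `W` good at `2`, its prime good with `a_ℓ` odd,
`(d/p) = 1` at odd bad `p`). [cite: Kramer1981, Prop. 3] [cite: Mazur1972, Cor. 4.4] [cite: GrossLMS1991, §1 (p. 235)] -/
theorem descAdmissibleUnram_neg_prime_of_silent {ℓ : ℕ} (hℓ : ℓ.Prime) (hℓ8 : ℓ % 8 = 3) (hℓ3 : ℓ ≠ 3) (h2N : ¬ 2 ∣ W.conductorNorm ℤ)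
    (hℓN : ∀ p : ℕ, p.Prime → p ∣ W.conductorNorm ℤ → p ≠ 2 → (ℓ : ZMod p) = -1)
    (hsilent : ∀ x : ZMod ℓ, 4 * x ^ 3 + ((integralModelInt W).b₂ : ZMod ℓ) * x ^ 2 +
        2 * ((integralModelInt W).b₄ : ZMod ℓ) * x + ((integralModelInt W).b₆ : ZMod ℓ) ≠ 0) :
    DescAdmissibleUnram W (-(ℓ : ℤ)) := by
  haveI := Fact.mk hℓ
  obtain ⟨-, hℓΔ, -⟩ := exists_heegnerField_of_prime_inert W hℓ hℓ8 hℓ3 h2N hℓN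
  have hℓ2 : ℓ ≠ 2 := by omega
  refine ⟨by have := hℓ.pos; omega, ?_, by omega, ?_, ?_, ?_⟩
  · rw [← Int.squarefree_natAbs]
    simpa using hℓ.squarefree
  · intro _
    by_contra h
    exact h2N ((W.dvd_conductorNorm_iff_not_hasGoodReductionAtPrime 2).mpr h)
  · intro q hq hqd
    have hqℓ : q = ℓ := by
      have h' : (q : ℤ) ∣ (ℓ : ℤ) := Int.dvd_neg.mp hqd
      exact (Nat.prime_dvd_prime_iff_eq hq hℓ).mp (by exact_mod_cast h')
    subst hqℓ
    exact ⟨fun _ => hasGoodReductionAtPrime_of_not_dvd W q hℓΔ, (silent_iff_odd_frobeniusTrace W hℓ2 hℓΔ).mp hsilent⟩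
  · intro p hp hp2 hbad
    haveI := Fact.mk hp
    have hpN : p ∣ W.conductorNorm ℤ := (W.dvd_conductorNorm_iff_not_hasGoodReductionAtPrime p).mpr (hbad ⟨hp⟩)
    have h1 : (ℓ : ZMod p) = -1 := hℓN p hp hpN hp2
    have hmod : (-(ℓ : ℤ)) % (p : ℤ) = 1 % (p : ℤ) := by
      have h' : ((-(ℓ : ℤ) : ℤ) : ZMod p) = ((1 : ℤ) : ZMod p) := by push_cast; rw [h1, neg_neg]
      exact (ZMod.intCast_eq_intCast_iff' _ _ _).mp h'
    rw [jacobiSym.mod_left, hmod, ← jacobiSym.mod_left, jacobiSym.one_left]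

/-- **Every K-clause of crux 22136 (with `2` INERT) + `DescAdmissibleUnram` + `E(ℚ_ℓ)[2] = 0`** for a silent prime Heegner field
`K = ℚ(√−ℓ)`, `ℓ ≡ 3 (mod 8)`, of a curve good at `2`: imaginary quadratic, `d_K = −ℓ` odd `≠ −3`, Heegner for `N_W`, `2` not split, the
two non-square clauses, `DescAdmissibleUnram W (−ℓ)`, and `E(ℚ_ℓ)[2] = 0` (Mazur–Rubin's «`ℓ ∉ T`»: DEF(W,K) = 1 on `Δ > 0`).
[cite: MazurRubin2010, Lemma 2.2 (i) and Cor. 3.4 (ii)] [cite: GrossLMS1991, §1 (p. 235)] -/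
theorem exists_silent_heegnerField_of_prime_inert {ℓ : ℕ} (hℓ : ℓ.Prime) (hℓ8 : ℓ % 8 = 3) (hℓ3 : ℓ ≠ 3) (h2N : ¬ 2 ∣ W.conductorNorm ℤ)
    (hℓN : ∀ p : ℕ, p.Prime → p ∣ W.conductorNorm ℤ → p ≠ 2 → (ℓ : ZMod p) = -1)
    (hsilent : ∀ x : ZMod ℓ, 4 * x ^ 3 + ((integralModelInt W).b₂ : ZMod ℓ) * x ^ 2 +
        2 * ((integralModelInt W).b₄ : ZMod ℓ) * x + ((integralModelInt W).b₆ : ZMod ℓ) ≠ 0) :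
    DescAdmissibleUnram W (-(ℓ : ℤ)) ∧
    (∀ [Fact ℓ.Prime], ∀ Q : (W.baseChange ℚ_[ℓ]).toAffine.Point, 2 • Q = 0 → Q = 0) ∧
    ∃ (K : Type) (_ : Field K) (_ : NumberField K), IsImaginaryQuadratic K ∧ discr K = -(ℓ : ℤ) ∧ Odd (discr K) ∧
      discr K ≠ -3 ∧ SatisfiesHeegnerHypothesis (W.conductorNorm ℤ) K ∧
      ((Ideal.span {(2 : ℤ)}).primesOver (𝓞 K)).ncard ≠ 2 ∧
      ¬ IsSquare ((discr K : ℚ) * -|W.Δ|) ∧ ¬ IsSquare ((discr K : ℚ) * (-(2 * |W.Δ|))) := by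
  obtain ⟨-, hℓΔ, hK⟩ := exists_heegnerField_of_prime_inert W hℓ hℓ8 hℓ3 h2N hℓN
  have hℓ2 : ℓ ≠ 2 := by omega
  exact ⟨descAdmissibleUnram_neg_prime_of_silent W hℓ hℓ8 hℓ3 h2N hℓN hsilent,
    fun Q hQ => twoTorsion_padic_eq_zero_of_forall_ne W hℓ2 hℓΔ hsilent Q hQ, hK⟩

/-! ## §109 `{Δ > 0, #Sel₂(E) = 1, 2 ∤ N}`: every silent `ℓ ≡ 3 (mod 8)` supplies a Sel₂-minimal twin — unconditionally -/

/-- **SUPPLY″-Selmer on `{Δ_W > 0, #Sel₂(W) = 1, 2 ∤ N_W}` with `2` INERT — UNCONDITIONAL** (T-A⁵ `F1Sign2.UnramifiedTwistSelmerShiftAtTwo`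
is the tree theorem `GenusKolyArch.unramifiedTwistSelmerShiftAtTwo_holds`: Kramer Prop. 6 + Mazur's norm theorem at `2`). `W/ℚ` globally
minimal elliptic, `Δ_W > 0`, no rational `2`-torsion abscissa, `#Sel₂(W) = 1`, `2 ∤ N_W`; `ℓ ≡ 3 (8)`, `ℓ ≡ −1 (p ∣ N_W odd)` SILENT ⟹
`K = ℚ(√−ℓ)` has every K-clause of crux 22136 with `2` inert, `E(ℚ_ℓ)[2] = 0` (DEF = 1), and a GLOBALLY MINIMAL twin `Wd ≅ W^{(−ℓ)}`
with `#Sel₂(Wd) = 2`. The `2`-inert companion of g7's `supply_DEF1_posDisc_of_shift`; the twin's analytic rank is NOT asserted.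
[cite: Kramer1981, Props. 3, 6, Thm. 1] [cite: Mazur1972, Cor. 4.4] [cite: MazurRubin2010, Lemma 2.10 (v), Cor. 3.4 (i)] -/
theorem supply_DEF1_posDisc_inert (hΔ : 0 < W.Δ) (ht : NoRationalTwoTorsion W) (h1 : Nat.card (W.selmerGroup 2) = 1)
    (h2N : ¬ 2 ∣ W.conductorNorm ℤ) {ℓ : ℕ} (hℓ : ℓ.Prime) (hℓ8 : ℓ % 8 = 3) (hℓ3 : ℓ ≠ 3)
    (hℓN : ∀ p : ℕ, p.Prime → p ∣ W.conductorNorm ℤ → p ≠ 2 → (ℓ : ZMod p) = -1)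
    (hsilent : ∀ x : ZMod ℓ, 4 * x ^ 3 + ((integralModelInt W).b₂ : ZMod ℓ) * x ^ 2 +
        2 * ((integralModelInt W).b₄ : ZMod ℓ) * x + ((integralModelInt W).b₆ : ZMod ℓ) ≠ 0) :
    ∃ (K : Type) (_ : Field K) (_ : NumberField K), IsImaginaryQuadratic K ∧ discr K = -(ℓ : ℤ) ∧ Odd (discr K) ∧
      discr K ≠ -3 ∧ SatisfiesHeegnerHypothesis (W.conductorNorm ℤ) K ∧
      ¬ IsSquare ((discr K : ℚ) * -|W.Δ|) ∧ ¬ IsSquare ((discr K : ℚ) * (-(2 * |W.Δ|))) ∧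
      ((Ideal.span {(2 : ℤ)}).primesOver (𝓞 K)).ncard ≠ 2 ∧
      (∀ [Fact ℓ.Prime], ∀ Q : (W.baseChange ℚ_[ℓ]).toAffine.Point, 2 • Q = 0 → Q = 0) ∧
      ∃ (Wd : WeierstrassCurve ℚ) (_ : Wd.IsElliptic) (_ : Wd.IsGloballyMinimal),
        (∃ C : VariableChange ℚ, C • W.quadraticTwist (discr K : ℚ) = Wd) ∧ Nat.card (Wd.selmerGroup 2) = 2 := by
  obtain ⟨hDA, hloc, K, _, _, hK, hd, hodd, hd3, hH, h2K, hsq1, hsq2⟩ :=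
    exists_silent_heegnerField_of_prime_inert W hℓ hℓ8 hℓ3 h2N hℓN hsilent
  have htwist : twistSelmerTwoCard W (-(ℓ : ℤ)) = 2 := by
    rcases unramifiedTwistSelmerShiftAtTwo_holds W hΔ ht (-(ℓ : ℤ)) hDA with h | h
    · rw [selmerTwoCard, h1] at h
      omega
    · rw [h, selmerTwoCard, h1]
  have hd0 : ((discr K : ℤ) : ℚ) ≠ 0 := by exact_mod_cast NumberField.discr_ne_zero K
  haveI := W.isElliptic_quadraticTwist hd0
  obtain ⟨C, hC⟩ := hasGlobalMinimalModel_rat_holds (W.quadraticTwist ((discr K : ℤ) : ℚ))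
  haveI := hC
  refine ⟨K, inferInstance, inferInstance, hK, hd, hodd, hd3, hH, hsq1, hsq2, h2K, hloc,
    C • W.quadraticTwist ((discr K : ℤ) : ℚ), inferInstance, hC, ⟨C, rfl⟩, ?_⟩
  rw [natCard_selmerGroup_model_eq_twistSelmerTwoCard W (NumberField.discr_ne_zero K) _ ⟨C, rfl⟩, hd, htwist]

omit W in
/-- **The visibility dichotomy for UNRAMIFIED-admissible twists (the `2`-inert companion of T-V `StrictShaPropagationAtTwo`).** For every
globally minimal elliptic `W/ℚ` with `Δ_W > 0` and `#Sel₂(W) = 4`: EITHER every `d` with `DescAdmissibleUnram W d` has `#Sel₂(W^{(d)}) = 2`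
(some Selmer class of `W` non-trivial at `∞`) OR every such `d` has `#Sel₂(W^{(d)}) = 8` (`Sel₂(W)` strict at `∞`). Unconditional.
[cite: Kramer1981, §2 Props. 3, 6] [cite: MazurRubin2010, Thm. 2.7, Cor. 3.4 (i)] [cite: CremonaMazur2000, §3] -/
theorem strictShaPropagation_unram (W : WeierstrassCurve ℚ) [W.IsElliptic] [W.IsGloballyMinimal] (hΔ : 0 < W.Δ)
    (h4 : selmerTwoCard W = 4) :
    (∀ d : ℤ, DescAdmissibleUnram W d → twistSelmerTwoCard W d = 2) ∨
      (∀ d : ℤ, DescAdmissibleUnram W d → twistSelmerTwoCard W d = 8) := by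
  by_cases hstrict : ∀ c ∈ (W.kummerSelmerStructure ((2 : ℕ) : ℤ)).selmerGroup,
      galoisCohomology.localization (W.torsionGaloisModule ((2 : ℕ) : ℤ)) (Sum.inl Rat.infinitePlace) 1 c = 0
  · right
    intro d hd
    rw [twistSelmerTwoCard_eq_two_mul_of_strict_unram W hΔ hstrict hd, h4]
  · left
    push Not at hstrict
    obtain ⟨c, hc, hne⟩ := hstrict
    intro d hd
    have h := two_mul_twistSelmerTwoCard_eq_of_exists_unram W hΔ ⟨c, hc, hne⟩ hd
    omega

omit W in
/-- **Unramified- and split-admissible twists fall on the SAME side of the dichotomy** (`Δ_W > 0`, any `#Sel₂(W)`): for `d` with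
`DescAdmissible W d` and `d'` with `DescAdmissibleUnram W d'`, `#Sel₂(W^{(d)}) = 2 ↔ #Sel₂(W^{(d')}) = 2` — both are decided by the
strictness of `Sel₂(W)` at `∞` (this is T-A⁵′ `mixedTwistSelmerLevelAtTwo_holds` read as an `iff`). Unconditional.
[cite: Kramer1981, §2 Props. 3, 6] [cite: MazurRubin2010, Thm. 2.7, Cor. 3.4 (i)] -/
theorem twistSelmerTwoCard_unram_eq_iff_admissible (W : WeierstrassCurve ℚ) [W.IsElliptic] [W.IsGloballyMinimal] (hΔ : 0 < W.Δ)
    (ht : NoRationalTwoTorsion W) {d d' : ℤ} (hd : DescAdmissible W d) (hd' : DescAdmissibleUnram W d') :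
    twistSelmerTwoCard W d = 2 ↔ twistSelmerTwoCard W d' = 2 := by
  rw [mixedTwistSelmerLevelAtTwo_holds W hΔ ht d d' hd hd']

end Summit.BirchSwinnertonDyer.BirchSwinnertonDyer.Theorems.GenusKolyTwin

end
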